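import Summits.QuantumFields.BalabanUV.Beta.GAN24.DiagramDecayAlgebra

/-!
# `BalabanUV.Beta.GAN24.DiagramDecayVertices` — binder row G-an2-4 ∕ (CONV-C), route R7 «TWO CURRENCIES», PART 131: VERTICES, TADPOLES AND THE LOCAL FUNCTIONALS OF DECAYING
# RATE-TOWERS.  Continues PART 130's diagram algebra of the pair «(UD) level-uniform entry decay + (SR) King's two-level shape» with volume-free constants: dressing a (UD)(+(SR))
# kernel by local ∕ decaying VERTEX LEGS (`Γ₁KΓ₂ᴴ`; with PART 130 §5 this is the general one-loop diagram `Γ₁(G_k ⊗ₖ G′_k)Γ₂ᴴ`), diagonal parts (TADPOLES `δ_{xy}c_k(x,x)`) and bounded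
# potentials, and the WEIGHTED LOCAL FUNCTIONALS `b_k(x) = Σ_y c_k(x,y)·w(x,y)` with sub-exponential weights `‖w‖ ≤ W·e^{ε·dist}` (the torus β-coefficient shadows: `w = x_μx_ν`-type
# weights are dominated by `e^{ε·dist}` for every `ε > 0`): `‖b_{k+1}(x) − b_k(x)‖ ≤ B′WS·θ^k`, hence `b_k(x) → b_∞(x)` with `‖b_k(x) − b_∞(x)‖ ≤ (B′WS∕(1−θ))·θ^k` — LITERALLY the
# (AF-0r) shape `|β⁰_k − β⁰_∞| ≤ c₀θ^k` of `Beta.Assembly.LimitForm.conv`, for every such functional of every (SR) tower, constants free of the level and of the volume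
# (unit b2b-balaban-gan24-p3, gen 53; v1)

NOT IN PRINT; OUR PROOF ([folklore] finite sums BY NAME over PART 130 (`norm_mul_apply_le_of_decay`, `entryDecay_add`, `exists_limit_of_geometric_step`), the row owner's
`DecayRateInterpolation` (`EntryDecay`, `TwoLevelDecayRate`); method references only: [Rivasseau1991] §III.1 (tree decay), [King1986] Lemma 4.5 (4.38) p. 674 (shape),
[Balaban1987RG1] (1.22) p. 264 (the β-coefficient as a weighted lattice sum of the polarization kernel — the SHAPE of §3's functionals; nothing printed is a hypothesis).
HONEST FRAMING (cell contract, verbatim): «discharging `BetaPertH` makes Bałaban's UV stability UNCONDITIONAL — a real constructive-QFT result; it is NOT the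
continuum limit and NOT the Clay problem.»  HONEST DEPENDENCY (verbatim): «continuum YM on T⁴ ⇐ BetaPertH ∧ nine spine estimates (0/9 proved); BetaPertH ⇐
(D1) ∧ (D4) ∧ CAP+tail; G-an2-4 gates asym, D1 and NE2/3/4.»

WHAT THIS FILE PROVES (0 sorry, 0 `def`, nothing cited; `n, p` index types (`p` finite), `dist : n → n → ℝ`, `dp : p → p → ℝ`, legs' cross-distance `D : n → p → ℝ`):
* §1 VERTEX DRESSING: **`entryDecay_vertexDress`** — legs `‖Γᵢ x u‖ ≤ γᵢe^{−κD(x,u)}`, `EntryDecay dp K B κ`, `D(x,v) ≤ D(x,u) + dp(u,v)`, `dist(x,y) ≤ D(x,u) + D(y,u)`, letters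
  `Σ_u e^{−(κ∕2)D(x,u)} ≤ S₁`, `Σ_u e^{−(κ∕4)D(x,u)} ≤ S₂` ⟹ `EntryDecay dist (Γ₁KΓ₂ᴴ) (γ₁Bγ₂·S₁S₂) (κ∕4)`; **`twoLevelDecayRate_vertexDress`** — the (SR) twin for a tower `K_k`
  through FIXED legs (`Γ₁K_{k+1}Γ₂ᴴ − Γ₁K_kΓ₂ᴴ = Γ₁(K_{k+1} − K_k)Γ₂ᴴ`).
* §2 DIAGONALS ∕ POTENTIALS: `entryDecay_diagonal_diag` (the tadpole `diagonal (x ↦ M x x)` keeps `(B, δ)`), `entryDecay_diagonal_mul` ∕ `entryDecay_mul_diagonal` (a potential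
  `‖w‖_∞ ≤ W` multiplies the constant by `W`), and the (SR) twins `twoLevelDecayRate_diagonal_diag`, `twoLevelDecayRate_diagonal_mul`, `twoLevelDecayRate_mul_diagonal`.
* §3 LOCAL FUNCTIONALS: **`norm_rowSum_weighted_le`** (`EntryDecay M B δ`, `‖w x y‖ ≤ We^{ε·dist(x,y)}`, letter `Σ_y e^{−(δ−ε)dist(x,y)} ≤ S` ⟹ `‖Σ_y M(x,y)w(x,y)‖ ≤ BWS`),
  **`norm_step_rowSum_weighted_le`** ((SR) ⟹ `‖b_{k+1}(x) − b_k(x)‖ ≤ B′WS·θ^k`), **`exists_limit_rowSum_weighted`** ((SR), `θ < 1` ⟹ `∃ b_∞(x)`, `b_k(x) → b_∞(x)`,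
  `‖b_k(x) − b_∞(x)‖ ≤ (B′WS)·θ^k∕(1−θ)` — the (AF-0r) SHAPE), `norm_limit_rowSum_weighted_le` (`‖b_∞(x)‖ ≤ B_∞WS` when the tower is also (UD)).
WHAT IT DOES NOT DO: name Bałaban's vertices (row an1); infinite volume (PART 133's socket); the identification of any torus functional with (1.22).  SUPPLIER work; no consumer
of record; NEVER «G-an2-4 closed»; NOT (CONV-C), NOT D1, NOT `BetaPertH`, NOT continuum, NOT Clay.  Records: `HOME/b2b-balaban-gan24-p3/gen53/README.md`.
-/

noncomputable section

open scoped BigOperators ComplexConjugate Matrix Matrix.Norms.L2Operator Kronecker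
open Filter Topology

namespace Summit.QuantumFields.BalabanUV.Beta.GAN24.DiagramDecayVertices

open Summit.QuantumFields.BalabanUV.T4Continuum.DecayRateInterpolation (EntryDecay DecayRate TwoLevelDecayRate)
open Summit.QuantumFields.BalabanUV.Beta.GAN24.DiagramDecayAlgebra (norm_mul_apply_le_of_decay entryDecay_add exists_limit_of_geometric_step)

/-! ## §1 Vertex dressing: `Γ₁·K·Γ₂ᴴ` with local ∕ decaying legs -/

section Vertex

variable {n p : Type*} [Fintype p] {dist : n → n → ℝ} {dp : p → p → ℝ} {D : n → p → ℝ}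

/-- **`entryDecay_vertexDress` — DRESSING A DECAYING KERNEL BY VERTEX LEGS** [folklore].  Legs `Γᵢ : n × p` with `‖Γᵢ x u‖ ≤ γᵢe^{−κ·D(x,u)}` (`γᵢ ≥ 0`), a kernel `K` on `p` with
`EntryDecay dp K B κ` (`B ≥ 0`, `κ ≥ 0`); «distances» with `D(x,v) ≤ D(x,u) + dp(u,v)`, `dist(x,y) ≤ D(x,u) + D(y,u)`, `dp, D ≥ 0`; letters `Σ_u e^{−(κ∕2)D(x,u)} ≤ S₁`,
`Σ_u e^{−(κ∕4)D(x,u)} ≤ S₂` ⟹ `EntryDecay dist (Γ₁KΓ₂ᴴ) (γ₁Bγ₂·S₁S₂) (κ∕4)` (two rectangular products, PART 130 §3).  For LOCAL vertices (legs of range `r`) the letters are ball volumes. -/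
theorem entryDecay_vertexDress (hDp : ∀ x u v, D x v ≤ D x u + dp u v) (hDD : ∀ x y u, dist x y ≤ D x u + D y u)
    (hdp0 : ∀ u v, 0 ≤ dp u v) (hD0 : ∀ x u, 0 ≤ D x u) {κ S₁ S₂ γ₁ γ₂ B : ℝ} (hκ : 0 ≤ κ) (hγ₁ : 0 ≤ γ₁) (hγ₂ : 0 ≤ γ₂) (hB : 0 ≤ B)
    (hS₁ : ∀ x, ∑ u, Real.exp (-(κ / 2 * D x u)) ≤ S₁) (hS₂ : ∀ x, ∑ u, Real.exp (-(κ / 4 * D x u)) ≤ S₂)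
    {Γ₁ Γ₂ : Matrix n p ℂ} {K : Matrix p p ℂ} (hΓ₁ : ∀ x u, ‖Γ₁ x u‖ ≤ γ₁ * Real.exp (-(κ * D x u))) (hΓ₂ : ∀ x u, ‖Γ₂ x u‖ ≤ γ₂ * Real.exp (-(κ * D x u)))
    (hK : EntryDecay dp K B κ) : EntryDecay dist (Γ₁ * K * Γ₂ᴴ) (γ₁ * B * γ₂ * (S₁ * S₂)) (κ / 4) := by
  classical
  rcases isEmpty_or_nonempty n with hn | hn
  · intro x; exact isEmptyElim x
  obtain ⟨x₀⟩ := hn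
  have hS₁0 : 0 ≤ S₁ := le_trans (Finset.sum_nonneg fun u _ => (Real.exp_pos _).le) (hS₁ x₀)
  -- first product `Γ₁K : n × p`, distance `D`, rate `κ/2`
  have h1 : ∀ x v, ‖(Γ₁ * K) x v‖ ≤ γ₁ * B * S₁ * Real.exp (-(κ / 2 * D x v)) :=
    norm_mul_apply_le_of_decay (d₁ := D) (d₂ := dp) (d := D) hDp hdp0 hκ hS₁ hΓ₁ hK hγ₁ hB
  -- second product `(Γ₁K)Γ₂ᴴ : n × n`, distances `D`, `Dᵀ`, `dist`, rate `κ/4`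
  have hΓ₂' : ∀ u y, ‖Γ₂ᴴ u y‖ ≤ γ₂ * Real.exp (-(κ / 2 * D y u)) := by
    intro u y
    rw [Matrix.conjTranspose_apply, norm_star]
    refine (hΓ₂ y u).trans (mul_le_mul_of_nonneg_left (Real.exp_le_exp.mpr ?_) hγ₂)
    have := hD0 y u; nlinarith
  have hS₂' : ∀ x, ∑ u, Real.exp (-(κ / 2 / 2 * D x u)) ≤ S₂ := fun x => by
    have h := hS₂ x; rwa [show κ / 4 = κ / 2 / 2 by ring] at h
  have hκ2 : 0 ≤ κ / 2 := by positivity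
  have h2 := norm_mul_apply_le_of_decay (d₁ := D) (d₂ := fun u y => D y u) (d := dist)
    (fun x u y => hDD x y u) (fun u y => hD0 y u) hκ2 hS₂' h1 hΓ₂' (by positivity) hγ₂
  intro x y
  have h := h2 x y
  rw [show κ / 2 / 2 = κ / 4 by ring] at h
  exact h.trans (le_of_eq (by ring))

/-- **`twoLevelDecayRate_vertexDress` — (SR) THROUGH FIXED VERTEX LEGS** [folklore]: under the hypotheses of `entryDecay_vertexDress` on the legs and distances, a tower `K_k` on `p` with
`TwoLevelDecayRate dp K B′ κ θ` (`B′ ≥ 0`, `θ ≥ 0`) dresses to `TwoLevelDecayRate dist (Γ₁K_kΓ₂ᴴ) (γ₁B′γ₂·S₁S₂) (κ∕4) θ` (`Γ₁K_{k+1}Γ₂ᴴ − Γ₁K_kΓ₂ᴴ = Γ₁(K_{k+1} − K_k)Γ₂ᴴ`). -/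
theorem twoLevelDecayRate_vertexDress (hDp : ∀ x u v, D x v ≤ D x u + dp u v) (hDD : ∀ x y u, dist x y ≤ D x u + D y u)
    (hdp0 : ∀ u v, 0 ≤ dp u v) (hD0 : ∀ x u, 0 ≤ D x u) {κ S₁ S₂ γ₁ γ₂ B' θ : ℝ} (hκ : 0 ≤ κ) (hγ₁ : 0 ≤ γ₁) (hγ₂ : 0 ≤ γ₂) (hB' : 0 ≤ B') (hθ : 0 ≤ θ)
    (hS₁ : ∀ x, ∑ u, Real.exp (-(κ / 2 * D x u)) ≤ S₁) (hS₂ : ∀ x, ∑ u, Real.exp (-(κ / 4 * D x u)) ≤ S₂)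
    {Γ₁ Γ₂ : Matrix n p ℂ} {K : ℕ → Matrix p p ℂ} (hΓ₁ : ∀ x u, ‖Γ₁ x u‖ ≤ γ₁ * Real.exp (-(κ * D x u))) (hΓ₂ : ∀ x u, ‖Γ₂ x u‖ ≤ γ₂ * Real.exp (-(κ * D x u)))
    (hK : TwoLevelDecayRate dp K B' κ θ) : TwoLevelDecayRate dist (fun k => Γ₁ * K k * Γ₂ᴴ) (γ₁ * B' * γ₂ * (S₁ * S₂)) (κ / 4) θ := by
  intro k
  have e : Γ₁ * K (k + 1) * Γ₂ᴴ - Γ₁ * K k * Γ₂ᴴ = Γ₁ * (K (k + 1) - K k) * Γ₂ᴴ := by rw [Matrix.mul_sub, Matrix.sub_mul]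
  have h := entryDecay_vertexDress hDp hDD hdp0 hD0 hκ hγ₁ hγ₂ (mul_nonneg hB' (pow_nonneg hθ k)) hS₁ hS₂ hΓ₁ hΓ₂ (hK k)
  rw [e]
  intro x y
  exact (h x y).trans (le_of_eq (by ring))

end Vertex

/-! ## §2 Diagonals (tadpoles) and bounded potentials -/

section Diagonal

variable {n : Type*} [Fintype n] [DecidableEq n] {dist : n → n → ℝ}

omit [Fintype n] in
/-- **the tadpole**: the diagonal part `diagonal (x ↦ M x x)` of a decaying kernel decays with the same `(B, δ)` (diagonal entries: `M`'s own bound; off-diagonal: `0`). [folklore] -/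
theorem entryDecay_diagonal_diag {M : Matrix n n ℂ} {B δ : ℝ} (hM : EntryDecay dist M B δ) : EntryDecay dist (Matrix.diagonal fun x => M x x) B δ := by
  intro x y
  by_cases hxy : x = y
  · subst hxy; rw [Matrix.diagonal_apply_eq]; exact hM x x
  · rw [Matrix.diagonal_apply_ne _ hxy, norm_zero]
    have hB : 0 ≤ B := nonneg_of_mul_nonneg_left ((norm_nonneg _).trans (hM x x)) (Real.exp_pos _)
    positivity

omit [Fintype n] in
/-- (SR) for the tadpole tower `diagonal (x ↦ c_k x x)`. [folklore] -/
theorem twoLevelDecayRate_diagonal_diag {c : ℕ → Matrix n n ℂ} {B δ θ : ℝ} (hc : TwoLevelDecayRate dist c B δ θ) :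
    TwoLevelDecayRate dist (fun k => Matrix.diagonal fun x => c k x x) B δ θ := by
  intro k
  have e : (Matrix.diagonal fun x => c (k + 1) x x) - (Matrix.diagonal fun x => c k x x) = Matrix.diagonal fun x => (c (k + 1) - c k) x x := by
    ext i j
    by_cases hij : i = j
    · subst hij; simp only [Matrix.sub_apply, Matrix.diagonal_apply_eq]
    · simp only [Matrix.sub_apply, Matrix.diagonal_apply_ne _ hij, sub_zero]
  rw [e]
  exact entryDecay_diagonal_diag (hc k)

/-- a bounded potential on the left: `‖w‖_∞ ≤ W` ⟹ `EntryDecay (diagonal w · M) (W·B) δ`. [folklore] -/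
theorem entryDecay_diagonal_mul {M : Matrix n n ℂ} {B δ W : ℝ} (hM : EntryDecay dist M B δ) {w : n → ℂ} (hw : ∀ x, ‖w x‖ ≤ W) :
    EntryDecay dist (Matrix.diagonal w * M) (W * B) δ := by
  intro x y
  rw [Matrix.diagonal_mul, norm_mul, mul_assoc]
  exact mul_le_mul (hw x) (hM x y) (norm_nonneg _) ((norm_nonneg _).trans (hw x))

/-- a bounded potential on the right: `EntryDecay (M · diagonal w) (W·B) δ`. [folklore] -/
theorem entryDecay_mul_diagonal {M : Matrix n n ℂ} {B δ W : ℝ} (hM : EntryDecay dist M B δ) {w : n → ℂ} (hw : ∀ x, ‖w x‖ ≤ W) :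
    EntryDecay dist (M * Matrix.diagonal w) (W * B) δ := by
  intro x y
  rw [Matrix.mul_diagonal, norm_mul, mul_comm, mul_assoc]
  exact mul_le_mul (hw y) (hM x y) (norm_nonneg _) ((norm_nonneg _).trans (hw y))

/-- (SR) through a FIXED bounded potential on the left. [folklore] -/
theorem twoLevelDecayRate_diagonal_mul {c : ℕ → Matrix n n ℂ} {B δ θ W : ℝ} (hc : TwoLevelDecayRate dist c B δ θ) {w : n → ℂ} (hw : ∀ x, ‖w x‖ ≤ W) :
    TwoLevelDecayRate dist (fun k => Matrix.diagonal w * c k) (W * B) δ θ := by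
  intro k
  rw [← Matrix.mul_sub, mul_assoc]
  exact entryDecay_diagonal_mul (hc k) hw

/-- (SR) through a FIXED bounded potential on the right. [folklore] -/
theorem twoLevelDecayRate_mul_diagonal {c : ℕ → Matrix n n ℂ} {B δ θ W : ℝ} (hc : TwoLevelDecayRate dist c B δ θ) {w : n → ℂ} (hw : ∀ x, ‖w x‖ ≤ W) :
    TwoLevelDecayRate dist (fun k => c k * Matrix.diagonal w) (W * B) δ θ := by
  intro k
  rw [← Matrix.sub_mul, mul_assoc]
  exact entryDecay_mul_diagonal (hc k) hw

end Diagonal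

/-! ## §3 Weighted local functionals: the torus β-coefficient shadows and the (AF-0r) shape -/

section Functional

variable {n : Type*} [Fintype n] {dist : n → n → ℝ}

/-- **`norm_rowSum_weighted_le` — A WEIGHTED ROW SUM OF A DECAYING KERNEL** [folklore]: `EntryDecay dist M B δ`, a weight `‖w x y‖ ≤ W·e^{ε·dist(x,y)}` (`W ≥ 0`) and the letter
`Σ_y e^{−(δ−ε)·dist(x,y)} ≤ S` ⟹ `‖Σ_y M(x,y)·w(x,y)‖ ≤ B·W·S`.  (Polynomial weights `|x_μx_ν| ≤ (1 + dist)²` are `≤ C_ε e^{ε·dist}` for every `ε > 0` — PART 132.) -/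
theorem norm_rowSum_weighted_le {M : Matrix n n ℂ} {B δ ε W S : ℝ} (hM : EntryDecay dist M B δ) {w : n → n → ℂ} (hw : ∀ x y, ‖w x y‖ ≤ W * Real.exp (ε * dist x y))
    (hW : 0 ≤ W) (hS : ∀ x, ∑ y, Real.exp (-((δ - ε) * dist x y)) ≤ S) (x : n) : ‖∑ y, M x y * w x y‖ ≤ B * W * S := by
  have hB : 0 ≤ B := nonneg_of_mul_nonneg_left ((norm_nonneg _).trans (hM x x)) (Real.exp_pos _)
  calc ‖∑ y, M x y * w x y‖ ≤ ∑ y, ‖M x y * w x y‖ := norm_sum_le _ _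
    _ ≤ ∑ y, B * W * Real.exp (-((δ - ε) * dist x y)) := by
        refine Finset.sum_le_sum fun y _ => ?_
        rw [norm_mul]
        calc ‖M x y‖ * ‖w x y‖ ≤ (B * Real.exp (-(δ * dist x y))) * (W * Real.exp (ε * dist x y)) :=
              mul_le_mul (hM x y) (hw x y) (norm_nonneg _) (mul_nonneg hB (Real.exp_pos _).le)
          _ = B * W * Real.exp (-((δ - ε) * dist x y)) := by
              rw [mul_mul_mul_comm, ← Real.exp_add]; congr 1; ring_nf
    _ = B * W * ∑ y, Real.exp (-((δ - ε) * dist x y)) := by rw [Finset.mul_sum]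
    _ ≤ B * W * S := mul_le_mul_of_nonneg_left (hS x) (mul_nonneg hB hW)

/-- **`norm_step_rowSum_weighted_le` — THE STEPS OF A LOCAL FUNCTIONAL OF AN (SR) TOWER ARE GEOMETRIC** [folklore]: `TwoLevelDecayRate dist c B′ δ θ`, the weight and letter of
`norm_rowSum_weighted_le` ⟹ `‖Σ_y c_{k+1}(x,y)w(x,y) − Σ_y c_k(x,y)w(x,y)‖ ≤ B′WS·θ^k` for every `k` and `x` — volume-free when `S` is. -/
theorem norm_step_rowSum_weighted_le {c : ℕ → Matrix n n ℂ} {B δ θ ε W S : ℝ} (hc : TwoLevelDecayRate dist c B δ θ) {w : n → n → ℂ}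
    (hw : ∀ x y, ‖w x y‖ ≤ W * Real.exp (ε * dist x y)) (hW : 0 ≤ W) (hS : ∀ x, ∑ y, Real.exp (-((δ - ε) * dist x y)) ≤ S) (k : ℕ) (x : n) :
    ‖∑ y, c (k + 1) x y * w x y - ∑ y, c k x y * w x y‖ ≤ B * W * S * θ ^ k := by
  have e : ∑ y, c (k + 1) x y * w x y - ∑ y, c k x y * w x y = ∑ y, (c (k + 1) - c k) x y * w x y := by
    rw [← Finset.sum_sub_distrib]; refine Finset.sum_congr rfl fun y _ => ?_; rw [Matrix.sub_apply, sub_mul]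
  rw [e]
  exact (norm_rowSum_weighted_le (hc k) hw hW hS x).trans (le_of_eq (by ring))

/-- **`exists_limit_rowSum_weighted` — THE (AF-0r) SHAPE FOR EVERY WEIGHTED LOCAL FUNCTIONAL OF AN (SR) TOWER** [folklore]: under `TwoLevelDecayRate dist c B′ δ θ` with `θ < 1`, the
weight `‖w x y‖ ≤ We^{ε·dist(x,y)}` and the letter `Σ_y e^{−(δ−ε)dist(x,y)} ≤ S`, the functional `b_k(x) = Σ_y c_k(x,y)w(x,y)` converges, `b_k(x) → b_∞(x)`, with
`‖b_k(x) − b_∞(x)‖ ≤ (B′WS)·θ^k∕(1−θ)` for all `k` — `|β⁰_k − β⁰_∞| ≤ c₀θ^k` with `c₀ = B′WS∕(1−θ)` free of the volume when `S` is. [cite: Balaban1987RG1, (1.22) p.264 (shape of the functional)] -/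
theorem exists_limit_rowSum_weighted {c : ℕ → Matrix n n ℂ} {B δ θ ε W S : ℝ} (hc : TwoLevelDecayRate dist c B δ θ) (hθ1 : θ < 1) {w : n → n → ℂ}
    (hw : ∀ x y, ‖w x y‖ ≤ W * Real.exp (ε * dist x y)) (hW : 0 ≤ W) (hS : ∀ x, ∑ y, Real.exp (-((δ - ε) * dist x y)) ≤ S) (x : n) :
    ∃ binf : ℂ, Tendsto (fun k => ∑ y, c k x y * w x y) atTop (𝓝 binf) ∧ ∀ k, ‖∑ y, c k x y * w x y - binf‖ ≤ B * W * S * θ ^ k / (1 - θ) :=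
  exists_limit_of_geometric_step hθ1 fun k => norm_step_rowSum_weighted_le hc hw hW hS k x

/-- the limit functional is bounded by `B_∞·W·S` when the tower is also (UD) with constant `B_∞` (closedness). [folklore] -/
theorem norm_limit_rowSum_weighted_le {c : ℕ → Matrix n n ℂ} {B δ ε W S : ℝ} (hdec : ∀ k, EntryDecay dist (c k) B δ) {w : n → n → ℂ}
    (hw : ∀ x y, ‖w x y‖ ≤ W * Real.exp (ε * dist x y)) (hW : 0 ≤ W) (hS : ∀ x, ∑ y, Real.exp (-((δ - ε) * dist x y)) ≤ S) (x : n) {binf : ℂ}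
    (hlim : Tendsto (fun k => ∑ y, c k x y * w x y) atTop (𝓝 binf)) : ‖binf‖ ≤ B * W * S :=
  le_of_tendsto' ((continuous_norm.tendsto _).comp hlim) fun k => norm_rowSum_weighted_le (hdec k) hw hW hS x

end Functional

end Summit.QuantumFields.BalabanUV.Beta.GAN24.DiagramDecayVertices

end
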